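import Literature.Computability.QuantumComplexity.BQPProofs
import Literature.Computability.Cryptography.QuantumCircuitProofs
import Literature.Computability.Cryptography.QubitRegisterCliffordTProofs
import Literature.Computability.Complexity.Oracle
import HarnessLib

/-!
# The output kernel of a coin family with a reversible classical part, relative to an oracle

Family `QuantumAdvantage` / `PQC`; companion of `BQPProofs.lean` (the coin family
`coinFamily p m D`: one Hadamard gate on each of the `p n` coin wires, then a classical part
`D n`; `coinFamily_acceptProb`: its *acceptance* probability is a coin count). This file proves
the same for the **whole classical output** and **relative to an arbitrary oracle** `A` — the
classical part may contain oracle gates for `A`, which are permutation matrices, so a part built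
from `NOT`/`CNOT`/Toffoli words and oracle queries still maps basis states to basis states
(Bernstein–Vazirani 1997, proof of Thm. 8.3, relativised as in their §8.3; Bennett–Bernstein–
Brassard–Vazirani 1997, arXiv p. 4: "any classical deterministic computation can be carried out
reversibly so that only the input and the answer remain"):

* `coinFamily_runOn_oracle`: if `(D n).toMatrix A` maps `|x⟩|y⟩|0^m⟩ ↦ |out n x y⟩`, the family
  run on `x` relative to `A` produces `2^{-p(n)/2} ∑_y |out n x y⟩`;
* `coinFamily_kernelProb`: with `out n x` injective, the probability that the measured output
  string lies in an event `E` is `#{y ∈ {0,1}^{p|x|} | ofFn (out |x| x y) ∈ E} / 2^{p|x|}`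
  (Born rule on all wires, `QCircuit.outputPMF_apply_holds`, `cliffordT_isUnitary_holds`);
* `uniformProb_le_coinFamily_kernelProb`: hence `Pr_c[c ∈ T] ≤ Pr[output ∈ E]` whenever every
  coin string `c ∈ T` is sent to an output in `E` — the probability half of the named fact
  `Literature.Computability.Cryptography.kernelProb_ge_uniformProb_of_mem_FPRel` (`Cryptography/ShorAssembly.lean`);
* the other half as a **named fact**, `uniformOracleCoinSimulation`: the polynomial-time
  uniform reversible simulation, with oracle gates, of a polynomial-time oracle algorithm run on
  `⟨x, coins⟩`, its output written as a prefix of the register (the relativised classical core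
  of Bernstein–Vazirani's Thm. 8.3, in the shape of `uniformReversibleSimulation` of
  `BQPProofs.lean`, which is the coin-free-oracle, one-output-bit case and is proved in
  `SimUniformity.lean`); and `exists_uniform_kernelProb_ge_uniformProb`: the two halves give,
  for `G ∈ FP^A` and a coin polynomial `q`, a uniform family with
  `Pr_c[G ⟨x, c⟩ ∈ S] ≤ Pr[output has a prefix in S]`.

## References

* E. Bernstein, U. Vazirani, *Quantum complexity theory*, SIAM J. Comput. 26 (1997) 1411–1473,
  Thm. 8.3 (proof) and §8.3 (oracle QTMs).
* C. H. Bennett, E. Bernstein, G. Brassard, U. Vazirani, *Strengths and weaknesses of quantum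
  computing*, SIAM J. Comput. 26 (1997) 1510–1523 (arXiv:quant-ph/9701001, p. 4).
* M. A. Nielsen, I. L. Chuang, *Quantum Computation and Quantum Information*, CUP 2010, §2.2.5
  (Born rule).
-/

noncomputable section

namespace Literature.Computability.QuantumComplexity

open _root_.Computability Complexity Cryptography Matrix

/-! ### The coin layer relative to an oracle -/

section Layer

variable {n k m : ℕ}

/-- The Hadamard layer is oracle-free. [folklore] -/
theorem hadamardLayer_isOracleFree :
    (⟨hadamardLayer n k m⟩ : QCircuit cliffordT (n + (k + m))).IsOracleFree := by
  intro g hg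
  obtain ⟨i, -, rfl⟩ := List.mem_map.1 hg
  exact hOn_isOracleFree i

/-- The matrix of the Hadamard layer does not depend on the oracle. [folklore] -/
theorem hadamardLayer_toMatrix (A : Language Bool) :
    (⟨hadamardLayer n k m⟩ : QCircuit cliffordT (n + (k + m))).toMatrix A =
      (⟨hadamardLayer n k m⟩ : QCircuit cliffordT (n + (k + m))).toMatrix 0 :=
  QCircuit.toMatrix_eq_of_isOracleFree hadamardLayer_isOracleFree A 0

end Layer

/-! ### The final superposition and the output kernel relative to an oracle -/

section Kernel

variable {p m : ℕ → ℕ} {D : (n : ℕ) → QCircuit cliffordT (n + (p n + m n))}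
  {out : (n : ℕ) → QReg n → QReg (p n) → QReg (n + (p n + m n))} {A : Language Bool}

/-- **Final superposition, relative to an oracle** (Bernstein–Vazirani 1997, proof of Thm. 8.3,
relativised): if the classical part maps `|x⟩|y⟩|0^m⟩ ↦ |out x y⟩` relative to `A`, the coin
family produces `2^{-p(n)/2} ∑_y |out x y⟩` on input `x`. [cite: BernsteinVazirani1997SICOMP, Thm. 8.3 (proof), §8.3 (oracle machines)] -/
theorem coinFamily_runOn_oracle
    (hD : ∀ n (x : QReg n) (y : QReg (p n)),
      (D n).toMatrix A *ᵥ basisState (coinInput x y) = basisState (out n x y))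
    (n : ℕ) (x : QReg n) :
    ((coinFamily p m D).circ n).runOn A (basisState (padInput x (p n + m n))) =
      invSqrt2 ^ (p n) • ∑ y : QReg (p n), basisState (out n x y) := by
  rw [QCircuit.runOn, coinFamily_circ, QCircuit.toMatrix_append, ← Matrix.mulVec_mulVec,
    hadamardLayer_toMatrix A, hadamardLayer_mulVec_padInput, Matrix.mulVec_smul, Matrix.mulVec_sum]
  congr 1
  exact Finset.sum_congr rfl fun y _ => hD n x y

/-- The amplitude of `|z⟩` in the final superposition: `2^{-p(n)/2}` on the range of `out n x`,
else `0` (for `out n x` injective). [cite: BernsteinVazirani1997SICOMP, Thm. 8.3 (proof)] -/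
theorem coinFamily_runOn_oracle_apply
    (hD : ∀ n (x : QReg n) (y : QReg (p n)),
      (D n).toMatrix A *ᵥ basisState (coinInput x y) = basisState (out n x y))
    (hinj : ∀ n (x : QReg n), Function.Injective (out n x))
    (n : ℕ) (x : QReg n) (z : QReg (n + (p n + m n))) :
    ((coinFamily p m D).circ n).runOn A (basisState (padInput x (p n + m n))) z =
      if z ∈ Set.range (out n x) then invSqrt2 ^ (p n) else 0 := by
  rw [coinFamily_runOn_oracle hD]
  simp only [Pi.smul_apply, Finset.sum_apply, smul_eq_mul, basisState_apply]
  by_cases hz : z ∈ Set.range (out n x)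
  · obtain ⟨y, rfl⟩ := hz
    rw [if_pos ⟨y, rfl⟩, Finset.sum_eq_single y]
    · simp
    · intro y' _ hy'
      exact if_neg fun h => hy' (hinj n x h).symm
    · intro h; exact absurd (Finset.mem_univ _) h
  · rw [if_neg hz]
    simp only [mul_eq_zero]
    right
    exact Finset.sum_eq_zero fun y _ => if_neg fun h => hz ⟨y, h.symm⟩

/-- Squared amplitude of `|z⟩` in the final superposition, as a counting sum over the coins.
[cite: BernsteinVazirani1997SICOMP, Thm. 8.3 (proof)] -/
theorem coinFamily_normSq_runOn_oracle_apply
    (hD : ∀ n (x : QReg n) (y : QReg (p n)),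
      (D n).toMatrix A *ᵥ basisState (coinInput x y) = basisState (out n x y))
    (hinj : ∀ n (x : QReg n), Function.Injective (out n x))
    (n : ℕ) (x : QReg n) (z : QReg (n + (p n + m n))) :
    ‖((coinFamily p m D).circ n).runOn A (basisState (padInput x (p n + m n))) z‖ ^ 2 =
      (1 / 2 : ℝ) ^ (p n) * ∑ y : QReg (p n), (if z = out n x y then 1 else 0 : ℝ) := by
  rw [coinFamily_runOn_oracle_apply hD hinj]
  by_cases hz : z ∈ Set.range (out n x)
  · rw [if_pos hz, norm_invSqrt2_pow_sq]
    obtain ⟨y, rfl⟩ := hz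
    rw [Finset.sum_eq_single y]
    · simp
    · intro y' _ hy'
      exact if_neg fun h => hy' (hinj n _ h).symm
    · intro h; exact absurd (Finset.mem_univ _) h
  · rw [if_neg hz, Finset.sum_eq_zero fun y _ => if_neg fun h => hz ⟨y, h.symm⟩]
    simp

/-- Over Clifford+T, the probability that the measured output string of a circuit run on
`|x⟩|0^m⟩` relative to `A` lies in `E` is the Born mass of the outcomes read into `E`.
(Nielsen–Chuang 2010, §2.2.5.) [cite: NielsenChuang2010, §2.2.5] -/
theorem toReal_outputPMF_map_ofFn {N M : ℕ} (C : QCircuit cliffordT (N + M)) (x : QReg N) (E : Set (List Bool))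
    [DecidablePred (· ∈ E)] :
    (((C.outputPMF A x).map List.ofFn).toOuterMeasure E).toReal =
      ∑ z : QReg (N + M), if List.ofFn z ∈ E then ‖C.runOn A (basisState (padInput x M)) z‖ ^ 2 else 0 := by
  have hout := @QCircuit.outputPMF_apply_holds cliffordT N M cliffordT_isUnitary_holds A C x
  rw [PMF.toOuterMeasure_map_apply, PMF.toOuterMeasure_apply, tsum_fintype, ENNReal.toReal_sum (fun z _ => ?_)]
  · refine Finset.sum_congr rfl fun z _ => ?_
    simp only [Set.indicator, Set.mem_preimage]
    split_ifs
    · rw [hout, ENNReal.toReal_ofReal (sq_nonneg _)]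
    · rfl
  · simp only [Set.indicator]
    split_ifs
    · rw [hout]; exact ENNReal.ofReal_ne_top
    · exact ENNReal.zero_ne_top

/-- **The output kernel of a coin family, relative to an oracle** (Bernstein–Vazirani 1997,
proof of Thm. 8.3, last step, for all wires): with a classical part mapping
`|x⟩|y⟩|0^m⟩ ↦ |out x y⟩` relative to `A`, injectively in `y`, the measured output string is
`ofFn (out x y)` for a uniformly random coin string `y`: for every event `E`,
`Pr[output ∈ E] = #{y ∈ {0,1}^{p|x|} | ofFn (out x y) ∈ E} / 2^{p|x|}`. [cite: BernsteinVazirani1997SICOMP, Thm. 8.3 (proof), §8.3] -/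
theorem coinFamily_kernelProb
    (hD : ∀ n (x : QReg n) (y : QReg (p n)),
      (D n).toMatrix A *ᵥ basisState (coinInput x y) = basisState (out n x y))
    (hinj : ∀ n (x : QReg n), Function.Injective (out n x)) (x : List Bool) (E : Set (List Bool)) :
    (coinFamily p m D).kernelProb A x E =
      open scoped Classical in
      ((Finset.univ.filter fun y : QReg (p x.length) =>
          List.ofFn (out x.length x.get y) ∈ E).card : ℝ) / 2 ^ (p x.length) := by
  classical
  unfold QCircuitFamily.kernelProb QCircuitFamily.kernel
  rw [toReal_outputPMF_map_ofFn]
  have key : ∀ z : QReg (x.length + (p x.length + m x.length)),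
      (if List.ofFn z ∈ E then
          ‖((coinFamily p m D).circ x.length).runOn A (basisState (padInput x.get (p x.length + m x.length))) z‖ ^ 2
        else 0) =
        (1 / 2 : ℝ) ^ (p x.length) *
          ∑ y : QReg (p x.length), (if out x.length x.get y = z then (if List.ofFn z ∈ E then 1 else 0) else 0) := by
    intro z
    rw [coinFamily_normSq_runOn_oracle_apply hD hinj]
    by_cases hz : List.ofFn z ∈ E
    · simp only [hz, if_true]
      congr 1
      exact Finset.sum_congr rfl fun y _ => by simp only [eq_comm]
    · simp [hz]
  simp only [key, ← Finset.mul_sum]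
  rw [Finset.sum_comm]
  simp only [Finset.sum_ite_eq, Finset.mem_univ, if_true, Finset.sum_boole]
  rw [mul_comm, one_div, inv_pow, ← div_eq_mul_inv]

/-- **Coins to kernel probabilities**: if every coin string in `T` (of length `p |x|`) is sent
to an output read into `E`, then `Pr_c[c ∈ T] ≤ Pr[output ∈ E]`. [cite: BernsteinVazirani1997SICOMP, Thm. 8.3 (proof), §8.3] -/
theorem uniformProb_le_coinFamily_kernelProb
    (hD : ∀ n (x : QReg n) (y : QReg (p n)),
      (D n).toMatrix A *ᵥ basisState (coinInput x y) = basisState (out n x y))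
    (hinj : ∀ n (x : QReg n), Function.Injective (out n x)) (x : List Bool) (E T : Set (List Bool))
    (hTE : ∀ y : QReg (p x.length), List.ofFn y ∈ T → List.ofFn (out x.length x.get y) ∈ E) :
    uniformProb (p x.length) T ≤ (coinFamily p m D).kernelProb A x E := by
  classical
  rw [coinFamily_kernelProb hD hinj, uniformProb_eq_card_ofFn]
  refine div_le_div_of_nonneg_right ?_ (by positivity)
  exact_mod_cast Finset.card_le_card fun y hy => by
    simp only [Finset.mem_filter, Finset.mem_univ, true_and] at hy ⊢
    exact hTE y hy

end Kernel

/-! ### The relativised reversible simulation (named fact) and its use -/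

/-- **Uniform reversible simulation of polynomial-time oracle computations on coins**
(Bernstein–Vazirani 1997, proof of Thm. 8.3 `BPP ⊆ BQP` — "a synchronized, normal form
[reversible] version of `M`" run after the Fourier transform of the coin track — relativised
as in their §8.3 (oracle QTMs: the query is presented to the oracle on a designated track);
Bennett–Bernstein–Brassard–Vazirani 1997, arXiv p. 4, motivating their definition of oracle
QTMs: "any classical deterministic computation can be carried out reversibly so that only the
input and the answer remain"; circuit form: Arora–Barak 2009, Lemma 10.10 with Thm. 6.6 /
Remark 6.7 for uniformity). Statement over the tree's models, in
the shape of `uniformReversibleSimulation` (the unrelativised one-output-bit case, proved in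
`SimUniformity.lean`): for a string function `G ∈ FP^A` (`FPRel (Oracle.ofLanguage A)`: a
G01 oracle algorithm with polynomial-time step function, polynomially many rounds and
polynomially long queries) and a coin polynomial `q` there are a work-space bound `m`,
classical parts `D n` — Clifford+T circuits on `n + q(n) + m(n)` wires that may contain oracle
gates, which relative to `A` are permutation matrices — and output labels `out n x y` with

* the coin family "Hadamard on each coin wire, then `D n`" polynomial-time uniform;
* relative to `A`, `D n` maps the basis state `|x⟩|y⟩|0^{m(n)}⟩` to the basis state
  `|out n x y⟩`, injectively in the coins `y` (which are kept);
* the output `G ⟨x, y⟩` is a prefix of the read-out `ofFn (out n x y)` of all wires.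

Model adaptations, all standard: the machine's queries have data-dependent lengths `≤` its
polynomial, while an oracle gate `QGate.oracle ℓ e` has `ℓ` query wires — at a query step one
gate per length is applied, the registers of the unused lengths holding fixed dummy queries
(their answer bits are garbage); the output is moved to the front wires; no garbage needs to be
erased since all wires are measured and only a prefix is read.
[cite: BernsteinVazirani1997SICOMP, Thm. 8.3 (proof), §8.3 (oracle quantum Turing machines)] -/
def uniformOracleCoinSimulation : Prop :=
  ∀ (A : Language Bool) (G : List Bool → List Bool) (q : Polynomial ℕ),
    G ∈ FPRel (Oracle.ofLanguage A) →
      ∃ (m : ℕ → ℕ) (D : (n : ℕ) → QCircuit cliffordT (n + (q.eval n + m n)))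
        (out : (n : ℕ) → QReg n → QReg (q.eval n) → QReg (n + (q.eval n + m n))),
        (coinFamily (fun n => q.eval n) m D).IsUniform ∧
        (∀ n (x : QReg n) (y : QReg (q.eval n)),
            (D n).toMatrix A *ᵥ basisState (coinInput x y) = basisState (out n x y)) ∧
        (∀ n (x : QReg n), Function.Injective (out n x)) ∧
        ∀ n (x : QReg n) (y : QReg (q.eval n)),
          G (boolPair (List.ofFn x) (List.ofFn y)) <+: List.ofFn (out n x y)

/-- **Coins and oracle simulation give the kernel bound**: from `uniformOracleCoinSimulation`,
for `G ∈ FP^A` and a coin polynomial `q` there is a polynomial-time uniform Clifford+T family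
with oracle gates for `A` such that, for every input `x` and event `S`,
`Pr_{c ∈ {0,1}^{q|x|}}[G ⟨x, c⟩ ∈ S] ≤ Pr[the output has a prefix in S]` — the statement of
`Literature.Computability.Cryptography.kernelProb_ge_uniformProb_of_mem_FPRel`. [cite: BernsteinVazirani1997SICOMP, Thm. 8.3 (proof), §8.3] -/
theorem exists_uniform_kernelProb_ge_uniformProb (hsim : uniformOracleCoinSimulation)
    (A : Language Bool) (G : List Bool → List Bool) (q : Polynomial ℕ) (hG : G ∈ FPRel (Oracle.ofLanguage A)) :
    ∃ F : QCircuitFamily cliffordT, F.IsUniform ∧ ∀ (x : List Bool) (S : Set (List Bool)),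
      uniformProb (q.eval x.length) {c | G (boolPair x c) ∈ S} ≤ F.kernelProb A x {y | ∃ s ∈ S, s <+: y} := by
  obtain ⟨m, D, out, hU, hD, hinj, hout⟩ := hsim A G q hG
  refine ⟨coinFamily (fun n => q.eval n) m D, hU, fun x S => ?_⟩
  refine uniformProb_le_coinFamily_kernelProb (p := fun n => q.eval n) hD hinj x _ _ fun y hy => ?_
  refine ⟨G (boolPair x (List.ofFn y)), hy, ?_⟩
  have h := hout x.length x.get y
  rwa [List.ofFn_get] at h

end Literature.Computability.QuantumComplexity

end
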